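/-
Copyright (c) 2026 the pub-hodgecm-mathlib formalisation cell (harness21).  Prover seat hodgecm-mathlib-K2E3-p25 (g2), HCML Track B «K2-LIT»,
h413 = `stmt-HodgeConjecture-24833`, road (11-3-split-nsc), leaf (nsc-S-A′), brick (E4b-1γ, part 3e = THE LETTER L2) of the weak cell lemma (dealer D105′;
consumer: K2E3-p03's ★ `K2E3GL3PrincipalSeriesThreeCell.principalSeriesThreeCell_of_middle_of_open`, hypothesis `h2`).  2026-09-04.
-/
import Summits.HodgeConjecture.HodgeConjecture.Theorems.K2E3GL3BorelInducedJacquetQOpenCellMap       -- ★ part 2c `exists_openCellMap`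
import Summits.HodgeConjecture.HodgeConjecture.Theorems.K2E3GL3BorelInducedJacquetQOpenCellDescent   -- ★ part 3a `eq_of_mk_eq`, `smoothIndRep_mem_vanishingOn_Z`
import Summits.HodgeConjecture.HodgeConjecture.Theorems.K2E3GL3BorelInducedJacquetQOpenCellKernel    -- ★ part 3d `mk_eq_zero_of_integral_cellFn_eq_zero`
import Literature.NumberTheory.Automorphic.ParabolicSemidirect                                      -- ★ `continuous_blockDiagonalGL`
import HarnessLib

/-!
# K2_E3 road (h413), leaf (nsc-S-A′), brick E4b-1γ — THE OPEN CELL OF THE `(B, P_{(2,1)})` FILTRATION OF `r_P(Ind_B^{GL₃} χ)` (K2E3-p03's letter L2)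

Cell `pub/hodgecm-mathlib` (D-0151), Track B, seat K2E3-p25 (g2) (leaf owner ∕ architect).  `--supports stmt-HodgeConjecture-24833 --as helper`; THEOREMS ONLY
(no `def`, no instance, no notation, no `sorry`); never imports `Cruxes/…/Lines`.  COUNT-NEUTRAL.

THE MATHEMATICS ([BernsteinZelevinsky1977, Thm. 5.2 (geometric lemma, open orbit)]; [Casselman1995, Prop. 6.3.1, §6.3]).  `I = Ind_B^{GL₃(F)}(χ δ_B^{1/2})`, `P = P_{(2,1)}`,
`Z = {g ∣ g₁₀g₂₁ = g₁₁g₂₀}` (the complement of the open `(B,P)`-double coset), `J₂ ≤ r_P(I)` the classes of the functions vanishing on `Z`, `ι : GL₂ → M_P` the block embedding.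
**`openCell_letter`** (= hypothesis `h2` of ★ `principalSeriesThreeCell_of_middle_of_open`, BYTE FOR BYTE): there are a torus character `χ₂` and a linear map
`Ψ : J₂ → Ind_{B₂}^{GL₂}(χ₂ δ^{1/2})`, `GL₂`-EQUIVARIANT along `ι`, with TRIVIAL KERNEL.  Assembly of ★ parts 1–3d: `Ψ[f] = Ψ̃ f` (★ part 2c value formula
`Ψ̃f(g) = ∫ f(w·n(v)·ι̂(g)) dv`), well defined on classes by ★ part 3a (the cell map is `U_P`-invariant: ★ part 2b translation), equivariant by the value formula, and
injective by ★ part 3d.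

HONEST LABEL: HC_CM is proved only modulo the 7 printed citations (2 remaining named inputs: hLiu418 = stmt-HodgeConjecture-24832, h413 = stmt-HodgeConjecture-24833) until rung 0
closes; count-neutral helper (closes K2E3-p03's letter L2; the socket (CELL-3) `sig_K2E3GL3PrincipalSeriesThreeCell` then pends only L1 = (E4b-1β), K2E3-p21 (g7)).

## References
* [BernsteinZelevinsky1977] I. N. Bernstein, A. V. Zelevinsky, *Induced representations of reductive p-adic groups I*, Ann. Sci. ÉNS 10 (1977), Thm. 5.2.
* [Casselman1995] W. Casselman, *Introduction to the theory of admissible representations of p-adic reductive groups* (draft 1995), Prop. 6.3.1, §6.3.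
-/

set_option autoImplicit false
set_option linter.dupNamespace false

noncomputable section

open Function Representation MeasureTheory
open scoped MatrixGroups
open Literature.NumberTheory.Automorphic Literature.NumberTheory.GaloisRepresentations.IsNonarchimedeanLocalField
open Summit.HodgeConjecture.HodgeConjecture.Cruxes.H413.K2E3GL3BorelInducedJacquetQOpenCellAlgebra
open Summit.HodgeConjecture.HodgeConjecture.Cruxes.H413.K2E3GL3BorelInducedJacquetQOpenCellIntegrand
open Summit.HodgeConjecture.HodgeConjecture.Cruxes.H413.K2E3GL3BorelInducedJacquetQOpenCellMap
open Summit.HodgeConjecture.HodgeConjecture.Cruxes.H413.K2E3GL3BorelInducedJacquetQOpenCellDescent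
open Summit.HodgeConjecture.HodgeConjecture.Cruxes.H413.K2E3GL3BorelInducedJacquetQOpenCellKernel
open Summit.HodgeConjecture.HodgeConjecture.Cruxes.H413.K2E3GL3BorelInducedJacquetQFiltration

namespace Summit.HodgeConjecture.HodgeConjecture.Cruxes.H413.K2E3GL3BorelInducedJacquetQOpenCell

variable {F : Type} [Field F] [ValuativeRel F] [TopologicalSpace F] [IsNonarchimedeanLocalField F]

set_option maxHeartbeats 3200000 in  -- the letter's statement mentions `parabolicIndGL` (a `def` over `smoothIndRep`); every use of the ★ parts unfolds it
/-- **THE OPEN CELL (K2E3-p03's letter L2, byte for byte).**  For every torus character `χ`, every block embedding `ι : GL₂ → M_P` (`ι̂(g) = diag(g,1)`, continuous)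
and the subrepresentation `J₂ ≤ r_P(Ind_B χ)` of classes of functions vanishing on `Z`: there are `χ₂` and a linear `Ψ : J₂ → Ind_{B₂}^{GL₂}(χ₂ δ^{1/2})`,
`GL₂`-equivariant along `ι`, with trivial kernel. [cite: BernsteinZelevinsky1977, Thm. 5.2] [cite: Casselman1995, Prop. 6.3.1] -/
theorem openCell_letter (χ : (Π a : Fin 3, GL {i : Fin 3 // (id : Fin 3 → Fin 3) i = a} F) →* ℂˣ) :
    ∀ ι : GL (Fin 2) F →* (Π a, GL {i // (![0, 0, 1] : Fin 3 → Fin 2) i = a} F),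
      (∀ g : GL (Fin 2) F, ((blockDiagonalGL F (![0, 0, 1] : Fin 3 → Fin 2) (ι g) : GL (Fin 3) F) : Matrix (Fin 3) (Fin 3) F) =
      !![(g : Matrix (Fin 2) (Fin 2) F) 0 0, (g : Matrix (Fin 2) (Fin 2) F) 0 1, 0;
      (g : Matrix (Fin 2) (Fin 2) F) 1 0, (g : Matrix (Fin 2) (Fin 2) F) 1 1, 0;
      0, 0, 1]) → Continuous ι →
      ∀ J₂ : Subrepresentation (jacquetGL F (![0, 0, 1] : Fin 3 → Fin 2) (parabolicIndGL F (id : Fin 3 → Fin 3)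
      ((Representation.trivial ℂ (Π a : Fin 3, GL {i : Fin 3 // (id : Fin 3 → Fin 3) i = a} F) ℂ).twist χ))),
      (∀ x, x ∈ J₂ ↔ ∃ f ∈ vanishingOn (standardParabolicGL F (id : Fin 3 → Fin 3))
      (Representation.twist (((Representation.trivial ℂ (Π a : Fin 3, GL {i : Fin 3 // (id : Fin 3 → Fin 3) i = a} F) ℂ).twist χ).comp
      (leviProjection F (id : Fin 3 → Fin 3))) (rootDeltaChar (standardParabolicGL F (id : Fin 3 → Fin 3))))
      {g : GL (Fin 3) F | (g : Matrix (Fin 3) (Fin 3) F) 1 0 * (g : Matrix (Fin 3) (Fin 3) F) 2 1 -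
      (g : Matrix (Fin 3) (Fin 3) F) 1 1 * (g : Matrix (Fin 3) (Fin 3) F) 2 0 = 0},
      Coinvariants.mk (restrictUnipotentGL F (![0, 0, 1] : Fin 3 → Fin 2) (parabolicIndGL F (id : Fin 3 → Fin 3)
      ((Representation.trivial ℂ (Π a : Fin 3, GL {i : Fin 3 // (id : Fin 3 → Fin 3) i = a} F) ℂ).twist χ))) f = x) →
      ∃ (χ₂ : (Π a : Fin 2, GL {i : Fin 2 // (id : Fin 2 → Fin 2) i = a} F) →* ℂˣ)
      (Ψ : J₂.toSubmodule →ₗ[ℂ]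
      SmoothInd (standardParabolicGL F (id : Fin 2 → Fin 2))
      (Representation.twist (((Representation.trivial ℂ (Π a : Fin 2, GL {i : Fin 2 // (id : Fin 2 → Fin 2) i = a} F) ℂ).twist χ₂).comp
      (leviProjection F (id : Fin 2 → Fin 2))) (rootDeltaChar (standardParabolicGL F (id : Fin 2 → Fin 2))))),
      (∀ (g : GL (Fin 2) F) (a : J₂.toSubmodule),
      Ψ ⟨jacquetGL F (![0, 0, 1] : Fin 3 → Fin 2) (parabolicIndGL F (id : Fin 3 → Fin 3)
      ((Representation.trivial ℂ (Π a : Fin 3, GL {i : Fin 3 // (id : Fin 3 → Fin 3) i = a} F) ℂ).twist χ)) (ι g)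
      (a : (restrictUnipotentGL F (![0, 0, 1] : Fin 3 → Fin 2) (parabolicIndGL F (id : Fin 3 → Fin 3)
      ((Representation.trivial ℂ (Π a : Fin 3, GL {i : Fin 3 // (id : Fin 3 → Fin 3) i = a} F) ℂ).twist χ))).Coinvariants),
      J₂.apply_mem_toSubmodule (ι g) a.2⟩ =
      (parabolicIndGL F (id : Fin 2 → Fin 2)
      ((Representation.trivial ℂ (Π a : Fin 2, GL {i : Fin 2 // (id : Fin 2 → Fin 2) i = a} F) ℂ).twist χ₂)) g (Ψ a)) ∧
      ∀ a : J₂.toSubmodule, Ψ a = 0 → a = 0 := by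
  intro ι hι hιc J₂ hJ₂
  classical
  haveI : IsTopologicalRing F := inferInstance
  haveI : T2Space F := (isLocalField F).toT2Space
  haveI : LocallyCompactSpace F := (isLocalField F).toLocallyCompactSpace
  haveI : SecondCountableTopology F := Literature.NumberTheory.Automorphic.secondCountableTopology_localField F
  letI mF : MeasurableSpace F := borel F
  haveI : BorelSpace F := ⟨rfl⟩
  set μ : Measure F := Measure.addHaar with hμ
  have h02 : (0 : Fin 3) ≠ 2 := by decide
  have h12 : (1 : Fin 3) ≠ 2 := by decide
  -- abbreviations (all transparent `set`s)
  set σ' : Representation ℂ ↥(standardParabolicGL F (id : Fin 3 → Fin 3)) ℂ :=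
    Representation.twist (((Representation.trivial ℂ (Π a : Fin 3, GL {i : Fin 3 // (id : Fin 3 → Fin 3) i = a} F) ℂ).twist χ).comp
      (leviProjection F (id : Fin 3 → Fin 3))) (rootDeltaChar (standardParabolicGL F (id : Fin 3 → Fin 3))) with hσ'
  have hσ'U : ∀ (u : GL (Fin 3) F) (hu : u ∈ upperUnitriangular (Fin 3) F), σ' ⟨u, unipotentRadicalGL_le F (id : Fin 3 → Fin 3) hu⟩ = 1 :=
    fun u hu => inducingChar_eq_one_of_mem_upperUnitriangular χ u hu
  set D : GL (Fin 2) F →* GL (Fin 3) F := (blockDiagonalGL F (![0, 0, 1] : Fin 3 → Fin 2)).comp ι with hDdef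
  have hD : ∀ g : GL (Fin 2) F, ((D g : GL (Fin 3) F) : Matrix (Fin 3) (Fin 3) F) =
      !![(g : Matrix (Fin 2) (Fin 2) F) 0 0, (g : Matrix (Fin 2) (Fin 2) F) 0 1, 0;
         (g : Matrix (Fin 2) (Fin 2) F) 1 0, (g : Matrix (Fin 2) (Fin 2) F) 1 1, 0;
         0, 0, 1] := fun g => hι g
  have hDc : Continuous D := (continuous_blockDiagonalGL F (![0, 0, 1] : Fin 3 → Fin 2)).comp hιc
  have hDmem : ∀ g : GL (Fin 2) F, D g ∈ standardParabolicGL F (![0, 0, 1] : Fin 3 → Fin 2) := fun g => blockDiagonalGL_mem _ (ι g)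
  -- the cell map on `X_Z` (★ part 2c)
  obtain ⟨χ₂, Φ, hΦ⟩ := exists_openCellMap μ h02 h12 σ' hσ'U D hD hDc
  -- `U_P`-invariance (★ part 2b translation)
  have hΦU : ∀ (u : GL (Fin 3) F) (hu : u ∈ unipotentRadicalGL F (![0, 0, 1] : Fin 3 → Fin 2))
      (f : ↥(vanishingOn (standardParabolicGL F (id : Fin 3 → Fin 3)) σ'
        {g : GL (Fin 3) F | (g : Matrix (Fin 3) (Fin 3) F) 1 0 * (g : Matrix (Fin 3) (Fin 3) F) 2 1 - (g : Matrix (Fin 3) (Fin 3) F) 1 1 * (g : Matrix (Fin 3) (Fin 3) F) 2 0 = 0})),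
      Φ ⟨smoothIndRep (standardParabolicGL F (id : Fin 3 → Fin 3)) σ' u f, smoothIndRep_mem_vanishingOn_Z σ' (unipotentRadicalGL_le F _ hu) f.2⟩ = Φ f := by
    intro u hu f
    obtain ⟨a, b, rfl⟩ := exists_eq_uP h02 h12 hu
    refine SmoothInd.ext (funext fun g => ?_)
    rw [hΦ, hΦ]
    simp only [toFun_smoothIndRep_apply]
    exact integral_cellFn_mul_uP h02 h12 σ' D hD μ (f : SmoothInd (standardParabolicGL F (id : Fin 3 → Fin 3)) σ') g a b
  -- representatives of classes in `J₂`
  have hrep : ∀ a : J₂.toSubmodule, ∃ f, f ∈ vanishingOn (standardParabolicGL F (id : Fin 3 → Fin 3)) σ'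
      {g : GL (Fin 3) F | (g : Matrix (Fin 3) (Fin 3) F) 1 0 * (g : Matrix (Fin 3) (Fin 3) F) 2 1 - (g : Matrix (Fin 3) (Fin 3) F) 1 1 * (g : Matrix (Fin 3) (Fin 3) F) 2 0 = 0} ∧
      Coinvariants.mk (restrictUnipotentGL F (![0, 0, 1] : Fin 3 → Fin 2) (parabolicIndGL F (id : Fin 3 → Fin 3)
        ((Representation.trivial ℂ (Π a : Fin 3, GL {i : Fin 3 // (id : Fin 3 → Fin 3) i = a} F) ℂ).twist χ))) f =
        (a : (restrictUnipotentGL F (![0, 0, 1] : Fin 3 → Fin 2) (parabolicIndGL F (id : Fin 3 → Fin 3)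
          ((Representation.trivial ℂ (Π a : Fin 3, GL {i : Fin 3 // (id : Fin 3 → Fin 3) i = a} F) ℂ).twist χ))).Coinvariants) :=
    fun a => (hJ₂ _).1 a.2
  choose rep hrepZ hrepmk using hrep
  -- the descended map
  have hwd : ∀ (a : J₂.toSubmodule) (f : SmoothInd (standardParabolicGL F (id : Fin 3 → Fin 3)) σ')
      (hf : f ∈ vanishingOn (standardParabolicGL F (id : Fin 3 → Fin 3)) σ'
        {g : GL (Fin 3) F | (g : Matrix (Fin 3) (Fin 3) F) 1 0 * (g : Matrix (Fin 3) (Fin 3) F) 2 1 - (g : Matrix (Fin 3) (Fin 3) F) 1 1 * (g : Matrix (Fin 3) (Fin 3) F) 2 0 = 0}),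
      Coinvariants.mk (restrictUnipotentGL F (![0, 0, 1] : Fin 3 → Fin 2) (parabolicIndGL F (id : Fin 3 → Fin 3)
        ((Representation.trivial ℂ (Π a : Fin 3, GL {i : Fin 3 // (id : Fin 3 → Fin 3) i = a} F) ℂ).twist χ))) f =
        (a : (restrictUnipotentGL F (![0, 0, 1] : Fin 3 → Fin 2) (parabolicIndGL F (id : Fin 3 → Fin 3)
          ((Representation.trivial ℂ (Π a : Fin 3, GL {i : Fin 3 // (id : Fin 3 → Fin 3) i = a} F) ℂ).twist χ))).Coinvariants) →
      Φ ⟨rep a, hrepZ a⟩ = Φ ⟨f, hf⟩ :=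
    fun a f hf hfa => eq_of_mk_eq σ' Φ hΦU ⟨rep a, hrepZ a⟩ ⟨f, hf⟩ ((hrepmk a).trans hfa.symm)
  let Ψ : J₂.toSubmodule →ₗ[ℂ] SmoothInd (standardParabolicGL F (id : Fin 2 → Fin 2))
      (Representation.twist (((Representation.trivial ℂ (Π a : Fin 2, GL {i : Fin 2 // (id : Fin 2 → Fin 2) i = a} F) ℂ).twist χ₂).comp
        (leviProjection F (id : Fin 2 → Fin 2))) (rootDeltaChar (standardParabolicGL F (id : Fin 2 → Fin 2)))) :=
    { toFun := fun a => Φ ⟨rep a, hrepZ a⟩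
      map_add' := fun a b => by
        rw [hwd (a + b) (rep a + rep b) (Submodule.add_mem _ (hrepZ a) (hrepZ b))
          (by rw [map_add, hrepmk, hrepmk]; rfl), ← map_add]
        rfl
      map_smul' := fun z a => by
        rw [hwd (z • a) (z • rep a) (Submodule.smul_mem _ z (hrepZ a)) (by rw [map_smul, hrepmk]; rfl), ← map_smul]
        rfl }
  have hΨ : ∀ a : J₂.toSubmodule, Ψ a = Φ ⟨rep a, hrepZ a⟩ := fun _ => rfl
  refine ⟨χ₂, Ψ, fun g a => ?_, fun a ha => ?_⟩
  · -- equivariance: `ι(g)·[rep a] = [D(g)·rep a]`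
    have hmem : smoothIndRep (standardParabolicGL F (id : Fin 3 → Fin 3)) σ' (D g) (rep a) ∈ vanishingOn (standardParabolicGL F (id : Fin 3 → Fin 3)) σ'
        {g : GL (Fin 3) F | (g : Matrix (Fin 3) (Fin 3) F) 1 0 * (g : Matrix (Fin 3) (Fin 3) F) 2 1 - (g : Matrix (Fin 3) (Fin 3) F) 1 1 * (g : Matrix (Fin 3) (Fin 3) F) 2 0 = 0} :=
      smoothIndRep_mem_vanishingOn_Z σ' (hDmem g) (hrepZ a)
    rw [hΨ, hΨ, hwd _ _ hmem ?_]
    · refine SmoothInd.ext (funext fun g' => ?_)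
      rw [hΦ]
      change _ = (Φ ⟨rep a, hrepZ a⟩).toFun (g' * g)
      rw [hΦ, map_mul]
      simp only [toFun_smoothIndRep_apply, mul_assoc]
    · show _ = jacquetGL F (![0, 0, 1] : Fin 3 → Fin 2) _ (ι g) _
      rw [← hrepmk a, jacquetGL_mk]
      rfl
  · -- kernel
    have h0 : Φ ⟨rep a, hrepZ a⟩ = 0 := by rw [← hΨ]; exact ha
    have hint : ∀ g : GL (Fin 2) F, ∫ v : Fin 2 → F, (rep a).toFun
        (permGL (Equiv.swap (1 : Fin 3) 2 * Equiv.swap 0 1) * (transvectionUnit 0 2 h02 (v 0) * transvectionUnit 1 2 h12 (v 1)) * D g) ∂(Measure.pi fun _ : Fin 2 => μ) = 0 := by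
      intro g
      rw [← hΦ ⟨rep a, hrepZ a⟩ g, h0]
      rfl
    have hmk := mk_eq_zero_of_integral_cellFn_eq_zero μ h02 h12 σ' D hD (hrepZ a) hint
    apply Subtype.ext
    rw [Submodule.coe_zero, ← hrepmk a]
    exact hmk

end Summit.HodgeConjecture.HodgeConjecture.Cruxes.H413.K2E3GL3BorelInducedJacquetQOpenCell

end
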